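import Literature.Barriers.CriticalPhenomena.PlaquetteWalkHoleRootColumnLawAbove
import Literature.Barriers.CriticalPhenomena.PlaquetteWalkHoleRootRowLawWitness
import HarnessLib

/-!
# Barrier catalogue (SAWScalingLimit): the WOUND COST-`7` WITNESSES of the column above the root — the COLUMN LAW ABOVE THE ROOT ROW as a closed theorem
for every domain containing a `(k+5) × (y+2)` block («COLUMN WITNESSES»)

`Z → ∞` limit model of the printed Yang–Baxter weights [GlazmanManolescu2019, §1, eq. (1)]; the «RECTANGLE COEFFICIENT» line of the venture lane «pcv-sawmu»
(b-engine-1 g27). `PlaquetteWalkHoleRootColumnLawAbove.vertexFunctional_printed_zero_set_finite_above` proves that the printed vertex functional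
`VF_D(w.side W, f₀; ·)` at a rhombus `f₀ = (w.1 + k, w.2 + y)` strictly ABOVE the root row and not west of the root (`y ≥ 1`, `k ≥ 0`) is not identically zero
PROVIDED some wound class-`B2a` walk with a turning first arc in `f₀` and extended limit cost `5` exists at `f₀` (hypothesis `hex`). This file discharges `hex`
structurally for `k ≤ 1`, `1 ≤ y ≤ 2`: the `E`-frame member of the lane's census — east along the root row to the column of `f₀`, north up that column into
`f₀`, out through `W`, west along the row of `f₀`, down the column `w.1 − 2` past the hole, east along the row below the root, north up the column
`w.1 + k + 2`, west along the row of `f₀` back into `f₀` through its `E` side — is written down at the reference position `w = (4,2)` (§2, kernel certificates: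
class `B2a`, turning first arc, limit cost `7` with an `E` end, ONE mid-edge of the excursion on the eastern ray of the hole ⇒ odd ray count ⇒ wound), and
transported to every position by translation (§1, after `PlaquetteWalkHoleRootRowLawWitness.ΩG.exists_wound_cost_five_shift`: cost, class, first hit, arc sides
and ray parity are translation invariant). ★★★★★ `vertexFunctional_printed_exists_ne_zero_of_colBlock`: for EVERY finite face list `Dl` containing the block
`colBlock w k y` (`k ≤ 1`, `1 ≤ y ≤ 2`) and missing the hole `(w.1 − 1, w.2)`, the printed vertex functional at `(w.1 + k, w.2 + y)` is NOT identically zero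
on `(0, π)` — no hypothesis left. [GlazmanManolescu2019 §1 Fig. 1, eq. (1), §4.2, Lemma 2.1, Remark 2.2; Glazman2015WeightedSAW Lemma 3.1 (proof, pp. 6–7);
CourantRobbins1958 Ch. V App. §2]
-/

noncomputable section

open Set Function Complex

namespace Literature.Probability.RandomPlanarGeometry.SAW.YangBaxter

open Real
open Literature.Barriers.CriticalPhenomena.PlaquetteWalk

/-! ## §1 Transport of a wound cost-`7` witness with a turning first arc -/

namespace ΩG

variable {D : Set Face} {w r : Face}

/-- ★★★ **TRANSPORT OF A WOUND COST-`7` WITNESS WITH A TURNING FIRST ARC TO EVERY POSITION.** A class-`B2a` walk of the back-translated list at the reference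
root plaquette `(4,2)` and a reference rhombus `r₀`, with an odd eastern-ray count, a turning first arc in `r₀`, limit cost `7` and a vertical end side, yields
in `dom Dl`, at the translated root and rhombus, a class-`B2a` walk that is WOUND (`A_J ≠ 0`), has a turning first arc, limit cost `7` and the same end side.
[cite: GlazmanManolescu2019, §4.2 (translation invariance), Lemma 2.1] [cite: Glazman2015WeightedSAW, Lemma 3.1 (proof, pp. 6–7)]
[cite: CourantRobbins1958, Ch. V Appendix §2 (the even–odd rule)] -/
theorem exists_wound_cost_seven_turn_shift {Dl : List Face} {w r₀ : Face} {a' : MidEdge} {r' : Face} (ha : (w42.side .W).shiftBy (refShift w) = a')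
    (hrr : Face.shiftBy (refShift w) r₀ = r') (hr : RootedFace (dom Dl) a' r')
    (hr₀ : RootedFace (dom (Dl.map (Face.shiftBy (-refShift w)))) (w42.side .W) r₀)
    (ω₀ : ΩG (dom (Dl.map (Face.shiftBy (-refShift w)))) (w42.side .W) r₀) (h₀ : ω₀.IsB2a)
    (hodd : Odd ((Finset.range ω₀.Mv).filter fun j => eastRayB w42 (ω₀.2.nth (ω₀.2.firstHitG + j + 1)) = true).card)
    (hNS : arcKind (ω₀.2.sIn ω₀.2.firstHitG) (ω₀.2.sOut ω₀.2.firstHitG) ≠ .straight)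
    (hc : cost (slotOfSide ω₀.1) ω₀.2.mids = 7) (hv : ω₀.1 = .E ∨ ω₀.1 = .W) :
    ∃ (ω : ΩG (dom Dl) a' r') (h : ω.IsB2a), ω.AJ hr h (toC (midPt a')) ≠ 0 ∧
      arcKind (ω.2.sIn ω.2.firstHitG) (ω.2.sOut ω.2.firstHitG) ≠ .straight ∧ cost (slotOfSide ω.1) ω.2.mids = 7 ∧ (ω.1 = .E ∨ ω.1 = .W) := by
  subst ha hrr
  let ω : ΩG (dom Dl) ((w42.side .W).shiftBy (refShift w)) (Face.shiftBy (refShift w) r₀) :=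
    ⟨ω₀.1, (ω₀.2.shiftBy (refShift w)).castAll (preimage_dom_map_shiftBy_neg (refShift w) Dl) rfl
      (Face.side_shiftBy (refShift w) r₀ ω₀.1).symm⟩
  have hm : ω.2.mids = ω₀.2.mids.map (MidEdge.shiftBy (refShift w)) := rfl
  have h : ω.IsB2a := ΩG.isB2a_of_mids_shift hr₀ hm h₀
  refine ⟨ω, h, ?_, ?_, ?_, hv⟩
  · -- odd eastern count ⇒ AJ ≠ 0 at the reference ⇒ odd `W`-ray count of the root plaquette, translation invariant ⇒ AJ ≠ 0 at the translate
    have hA₀ := AJ_root_ne_zero_of_odd_card ω₀ hr₀ h₀ hodd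
    have hW₀ := (ω₀.AJ_root_ne_zero_iff_odd_rayCountAt (hr := hr₀) h₀ (b := w42) (τ := .W) rfl).1 hA₀
    have hW : Odd (ω.rayCountAt hr h (Face.shiftBy (refShift w) w42) .W) := by
      rw [ΩG.rayCountAt_W_of_mids_shift (hr := hr₀) (hr' := hr) hm h₀ h w42]; exact hW₀
    exact (ω.AJ_root_ne_zero_iff_odd_rayCountAt (hr := hr) h (b := Face.shiftBy (refShift w) w42) (τ := .W)
      (Face.side_shiftBy (refShift w) w42 .W)).2 hW
  · -- the first hit and the sides crossed by each arc are translation invariant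
    have hF : ω.2.firstHitG = ω₀.2.firstHitG := YBWalk.firstHitG_eq_of_mids_shift hm
    obtain ⟨e1, e2⟩ := YBWalk.sIn_sOut_eq_of_mids_shift hm (i := ω₀.2.firstHitG) (ω₀.fh_lt h₀)
    rw [hF, e1, e2]; exact hNS
  · show cost (slotOfSide ω₀.1) (ω₀.2.mids.map (MidEdge.shiftBy (refShift w))) = 7
    rw [cost_map_shiftBy]; exact hc

end ΩG

end Literature.Probability.RandomPlanarGeometry.SAW.YangBaxter

/-! ## §2 The reference witnesses at the root plaquette `(4,2)`: the `E`-frame member at the rhombi `(4+k, 2+y)`, `k ≤ 1`, `1 ≤ y ≤ 2` -/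

namespace Literature.Barriers.CriticalPhenomena.PlaquetteWalk

open Literature.Probability.RandomPlanarGeometry.SAW.YangBaxter
open Real Complex

section Reference

/-- The reference block of the column witness `(k, y)` (`k ≤ 1`, `1 ≤ y ≤ 2`; other arguments are sent to the nearest case): the faces visited by the witness —
the boundary of the rectangle `[2, 6+k] × [1, 2+y]` together with the root row segment `[4, 4+k] × {2}` and the column `{4+k} × [2, 2+y]`, never the hole `(3,2)`.
[cite: GlazmanManolescu2019, §2.1 (finite domains of faces)] -/
def colBlock42 : ℕ → ℕ → List Face
  | 0, 1 => [(2,1),(2,2),(2,3),(3,1),(3,3),(4,1),(4,2),(4,3),(5,1),(5,3),(6,1),(6,2),(6,3)]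
  | 1, 1 => [(2,1),(2,2),(2,3),(3,1),(3,3),(4,1),(4,2),(4,3),(5,1),(5,2),(5,3),(6,1),(6,3),(7,1),(7,2),(7,3)]
  | 0, _ => [(2,1),(2,2),(2,3),(2,4),(3,1),(3,4),(4,1),(4,2),(4,3),(4,4),(5,1),(5,4),(6,1),(6,2),(6,3),(6,4)]
  | _, 1 => [(2,1),(2,2),(2,3),(3,1),(3,3),(4,1),(4,2),(4,3),(5,1),(5,2),(5,3),(6,1),(6,3),(7,1),(7,2),(7,3)]
  | _, _ => [(2,1),(2,2),(2,3),(2,4),(3,1),(3,4),(4,1),(4,2),(4,4),(5,1),(5,2),(5,3),(5,4),(6,1),(6,4),(7,1),(7,2),(7,3),(7,4)]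

/-- The mid-edges of the column witness `(k, y)` (the `E`-frame member at `(4+k, 2+y)`): east along the root row to column `4+k`, north into `(4+k, 2+y)`, out
through `W`, west along row `2+y`, down column `2` past the hole, east along row `1`, north up column `6+k`, west along row `2+y` into `(4+k, 2+y)` through `E`.
[cite: GlazmanManolescu2019, §1 (definition of the model), Fig. 1] -/
def colMids42 : ℕ → ℕ → List MidEdge
  | 0, 1 => [.vert 4 2, .slant 4 3, .vert 4 3, .vert 3 3, .slant 2 3, .slant 2 2, .vert 3 1, .vert 4 1, .vert 5 1, .vert 6 1, .slant 6 2, .slant 6 3,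
      .vert 6 3, .vert 5 3]
  | 1, 1 => [.vert 4 2, .vert 5 2, .slant 5 3, .vert 5 3, .vert 4 3, .vert 3 3, .slant 2 3, .slant 2 2, .vert 3 1, .vert 4 1, .vert 5 1, .vert 6 1,
      .vert 7 1, .slant 7 2, .slant 7 3, .vert 7 3, .vert 6 3]
  | 0, _ => [.vert 4 2, .slant 4 3, .slant 4 4, .vert 4 4, .vert 3 4, .slant 2 4, .slant 2 3, .slant 2 2, .vert 3 1, .vert 4 1, .vert 5 1, .vert 6 1,
      .slant 6 2, .slant 6 3, .slant 6 4, .vert 6 4, .vert 5 4]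
  | _, 1 => [.vert 4 2, .vert 5 2, .slant 5 3, .vert 5 3, .vert 4 3, .vert 3 3, .slant 2 3, .slant 2 2, .vert 3 1, .vert 4 1, .vert 5 1, .vert 6 1,
      .vert 7 1, .slant 7 2, .slant 7 3, .vert 7 3, .vert 6 3]
  | _, _ => [.vert 4 2, .vert 5 2, .slant 5 3, .slant 5 4, .vert 5 4, .vert 4 4, .vert 3 4, .slant 2 4, .slant 2 3, .slant 2 2, .vert 3 1, .vert 4 1,
      .vert 5 1, .vert 6 1, .vert 7 1, .slant 7 2, .slant 7 3, .slant 7 4, .vert 7 4, .vert 6 4]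

/-- The column witness `(0, 1)` (at the rhombus just above the root plaquette) as a walk of its block. [cite: GlazmanManolescu2019, §1 (definition of the model), Fig. 1] -/
def colWalk01 : YBWalk (dom (colBlock42 0 1)) (w42.side .W) (Face.side ((4 : ℤ), (3 : ℤ)) .E) where
  mids := colMids42 0 1
  head_eq := by decide
  getLast_eq := by decide
  nodup := by decide
  arc_mem := arc_mem_of_check (by decide)
  isChain := by decide
  noncross := noncross_of_check (by decide)

/-- The column witness `(1, 1)` as a walk of its block. [cite: GlazmanManolescu2019, §1 (definition of the model), Fig. 1] -/
def colWalk11 : YBWalk (dom (colBlock42 1 1)) (w42.side .W) (Face.side ((5 : ℤ), (3 : ℤ)) .E) where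
  mids := colMids42 1 1
  head_eq := by decide
  getLast_eq := by decide
  nodup := by decide
  arc_mem := arc_mem_of_check (by decide)
  isChain := by decide
  noncross := noncross_of_check (by decide)

/-- The column witness `(0, 2)` as a walk of its block. [cite: GlazmanManolescu2019, §1 (definition of the model), Fig. 1] -/
def colWalk02 : YBWalk (dom (colBlock42 0 2)) (w42.side .W) (Face.side ((4 : ℤ), (4 : ℤ)) .E) where
  mids := colMids42 0 2
  head_eq := by decide
  getLast_eq := by decide
  nodup := by decide
  arc_mem := arc_mem_of_check (by decide)
  isChain := by decide
  noncross := noncross_of_check (by decide)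

/-- The column witness `(1, 2)` as a walk of its block. [cite: GlazmanManolescu2019, §1 (definition of the model), Fig. 1] -/
def colWalk12 : YBWalk (dom (colBlock42 1 2)) (w42.side .W) (Face.side ((5 : ℤ), (4 : ℤ)) .E) where
  mids := colMids42 1 2
  head_eq := by decide
  getLast_eq := by decide
  nodup := by decide
  arc_mem := arc_mem_of_check (by decide)
  isChain := by decide
  noncross := noncross_of_check (by decide)

/-- The labelled column witness `(0, 1)` (returns to the `E` side). [cite: Glazman2015WeightedSAW, Lemma 3.1 (proof, pp. 6–7: the classes of walks through a rhombus)] -/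
def ωC01 : ΩG (dom (colBlock42 0 1)) (w42.side .W) ((4 : ℤ), (3 : ℤ)) := ⟨.E, colWalk01⟩
/-- The labelled column witness `(1, 1)`. [cite: Glazman2015WeightedSAW, Lemma 3.1 (proof, pp. 6–7)] -/
def ωC11 : ΩG (dom (colBlock42 1 1)) (w42.side .W) ((5 : ℤ), (3 : ℤ)) := ⟨.E, colWalk11⟩
/-- The labelled column witness `(0, 2)`. [cite: Glazman2015WeightedSAW, Lemma 3.1 (proof, pp. 6–7)] -/
def ωC02 : ΩG (dom (colBlock42 0 2)) (w42.side .W) ((4 : ℤ), (4 : ℤ)) := ⟨.E, colWalk02⟩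
/-- The labelled column witness `(1, 2)`. [cite: Glazman2015WeightedSAW, Lemma 3.1 (proof, pp. 6–7)] -/
def ωC12 : ΩG (dom (colBlock42 1 2)) (w42.side .W) ((5 : ℤ), (4 : ℤ)) := ⟨.E, colWalk12⟩

/-- Certificates of the column witness `(0, 1)`: first hit `1`, `13` arcs, no later arc in the rhombus, ONE eastern-ray crossing (odd), turning first arc, limit cost `7`.
[cite: Glazman2015WeightedSAW, Lemma 3.1 (proof, pp. 6–7)] [cite: CourantRobbins1958, Ch. V Appendix §2 (the even–odd rule)] [cite: GlazmanManolescu2019, §1, eq. (1); Remark 2.2] -/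
theorem ωC01_cert : ωC01.2.firstHitG = 1 ∧ ωC01.2.arcs.length = 13 ∧ (∀ j < 13, 1 < j → ωC01.2.fc j ≠ ((4 : ℤ), (3 : ℤ))) ∧
    Odd ((Finset.range 12).filter fun j => eastRayB w42 (ωC01.2.nth (1 + j + 1)) = true).card ∧
    arcKind (ωC01.2.sIn 1) (ωC01.2.sOut 1) ≠ .straight ∧ cost (slotOfSide ωC01.1) ωC01.2.mids = 7 := by
  refine ⟨by decide, by decide, by decide, by decide, by decide, by decide⟩

/-- Certificates of the column witness `(1, 1)`: first hit `2`, `16` arcs, no later arc in the rhombus, odd eastern-ray count, turning first arc, cost `7`.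
[cite: Glazman2015WeightedSAW, Lemma 3.1 (proof, pp. 6–7)] [cite: CourantRobbins1958, Ch. V Appendix §2 (the even–odd rule)] [cite: GlazmanManolescu2019, §1, eq. (1); Remark 2.2] -/
theorem ωC11_cert : ωC11.2.firstHitG = 2 ∧ ωC11.2.arcs.length = 16 ∧ (∀ j < 16, 2 < j → ωC11.2.fc j ≠ ((5 : ℤ), (3 : ℤ))) ∧
    Odd ((Finset.range 14).filter fun j => eastRayB w42 (ωC11.2.nth (2 + j + 1)) = true).card ∧
    arcKind (ωC11.2.sIn 2) (ωC11.2.sOut 2) ≠ .straight ∧ cost (slotOfSide ωC11.1) ωC11.2.mids = 7 := by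
  refine ⟨by decide, by decide, by decide, by decide, by decide, by decide⟩

/-- Certificates of the column witness `(0, 2)`: first hit `2`, `16` arcs, no later arc in the rhombus, odd eastern-ray count, turning first arc, cost `7`.
[cite: Glazman2015WeightedSAW, Lemma 3.1 (proof, pp. 6–7)] [cite: CourantRobbins1958, Ch. V Appendix §2 (the even–odd rule)] [cite: GlazmanManolescu2019, §1, eq. (1); Remark 2.2] -/
theorem ωC02_cert : ωC02.2.firstHitG = 2 ∧ ωC02.2.arcs.length = 16 ∧ (∀ j < 16, 2 < j → ωC02.2.fc j ≠ ((4 : ℤ), (4 : ℤ))) ∧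
    Odd ((Finset.range 14).filter fun j => eastRayB w42 (ωC02.2.nth (2 + j + 1)) = true).card ∧
    arcKind (ωC02.2.sIn 2) (ωC02.2.sOut 2) ≠ .straight ∧ cost (slotOfSide ωC02.1) ωC02.2.mids = 7 := by
  refine ⟨by decide, by decide, by decide, by decide, by decide, by decide⟩

/-- Certificates of the column witness `(1, 2)`: first hit `3`, `19` arcs, no later arc in the rhombus, odd eastern-ray count, turning first arc, cost `7`.
[cite: Glazman2015WeightedSAW, Lemma 3.1 (proof, pp. 6–7)] [cite: CourantRobbins1958, Ch. V Appendix §2 (the even–odd rule)] [cite: GlazmanManolescu2019, §1, eq. (1); Remark 2.2] -/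
theorem ωC12_cert : ωC12.2.firstHitG = 3 ∧ ωC12.2.arcs.length = 19 ∧ (∀ j < 19, 3 < j → ωC12.2.fc j ≠ ((5 : ℤ), (4 : ℤ))) ∧
    Odd ((Finset.range 16).filter fun j => eastRayB w42 (ωC12.2.nth (3 + j + 1)) = true).card ∧
    arcKind (ωC12.2.sIn 3) (ωC12.2.sOut 3) ≠ .straight ∧ cost (slotOfSide ωC12.1) ωC12.2.mids = 7 := by
  refine ⟨by decide, by decide, by decide, by decide, by decide, by decide⟩

end Reference

/-! ## §3 Every position -/

section Translate

variable {Dl : List Face} {w : Face}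

/-- The column witness block `(k, y)` at the root plaquette `w`: the translate of `colBlock42 k y` (for `k ≤ 1`, `1 ≤ y ≤ 2`).
[cite: GlazmanManolescu2019, §2.1, §4.2 (translation invariance)] -/
def colBlock (w : Face) (k y : ℕ) : List Face := (colBlock42 k y).map (Face.shiftBy (refShift w))

/-- The translation carries the reference rhombus `(4+k, 2+y)` to `(w.1 + k, w.2 + y)`. [cite: GlazmanManolescu2019, §4.2 (translation invariance)] -/
theorem shiftBy_refShift_col (w : Face) (k y : ℤ) : Face.shiftBy (refShift w) (((4 : ℤ) + k, (2 : ℤ) + y) : Face) = (w.1 + k, w.2 + y) := by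
  obtain ⟨a, b⟩ := w; simp [Face.shiftBy, refShift]; constructor <;> ring

/-- The reference column witness `(0, 1)`, placed in the back-translated list containing its block: class `B2a`, odd eastern-ray count, turning first arc, limit cost `7`,
`E` end (one lemma per cell). [cite: Glazman2015WeightedSAW, Lemma 3.1 (proof, pp. 6–7)] [cite: CourantRobbins1958, Ch. V Appendix §2 (the even–odd rule)] -/
private theorem refWitnessC01 (hB₀ : ∀ c ∈ colBlock42 0 1, c ∈ Dl.map (Face.shiftBy (-refShift w))) :
    ∃ (ω₀ : ΩG (dom (Dl.map (Face.shiftBy (-refShift w)))) (w42.side .W) ((4 : ℤ), (3 : ℤ))) (_ : ω₀.IsB2a),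
      Odd ((Finset.range ω₀.Mv).filter fun j => eastRayB w42 (ω₀.2.nth (ω₀.2.firstHitG + j + 1)) = true).card ∧
      arcKind (ω₀.2.sIn ω₀.2.firstHitG) (ω₀.2.sOut ω₀.2.firstHitG) ≠ .straight ∧ cost (slotOfSide ω₀.1) ω₀.2.mids = 7 ∧ (ω₀.1 = .E ∨ ω₀.1 = .W) := by
  obtain ⟨hF, hn, hfc, hodd, hNS, hc⟩ := ωC01_cert
  let ω₀ : ΩG (dom (Dl.map (Face.shiftBy (-refShift w)))) (w42.side .W) ((4 : ℤ), (3 : ℤ)) := ⟨.E, colWalk01.mapDomain fun c hc => hB₀ c hc⟩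
  have hF' : ω₀.2.firstHitG = 1 := hF
  have hn' : ω₀.2.arcs.length = 13 := hn
  have h₀ : ω₀.IsB2a := by
    refine ΩG.isB2a_of_forall_fc_ne (by rw [hF', hn']; omega) fun j hj1 hj2 => ?_
    rw [hF'] at hj1; rw [hn'] at hj2
    exact hfc j hj2 hj1
  have hM : ω₀.Mv = 12 := by unfold ΩG.Mv; rw [hF', hn']
  exact ⟨ω₀, h₀, by rw [hM, hF']; exact hodd, by rw [hF']; exact hNS, hc, Or.inl rfl⟩

/-- The reference column witness `(1, 1)` in the back-translated list. [cite: Glazman2015WeightedSAW, Lemma 3.1 (proof, pp. 6–7)] [cite: CourantRobbins1958, Ch. V Appendix §2 (the even–odd rule)] -/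
private theorem refWitnessC11 (hB₀ : ∀ c ∈ colBlock42 1 1, c ∈ Dl.map (Face.shiftBy (-refShift w))) :
    ∃ (ω₀ : ΩG (dom (Dl.map (Face.shiftBy (-refShift w)))) (w42.side .W) ((5 : ℤ), (3 : ℤ))) (_ : ω₀.IsB2a),
      Odd ((Finset.range ω₀.Mv).filter fun j => eastRayB w42 (ω₀.2.nth (ω₀.2.firstHitG + j + 1)) = true).card ∧
      arcKind (ω₀.2.sIn ω₀.2.firstHitG) (ω₀.2.sOut ω₀.2.firstHitG) ≠ .straight ∧ cost (slotOfSide ω₀.1) ω₀.2.mids = 7 ∧ (ω₀.1 = .E ∨ ω₀.1 = .W) := by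
  obtain ⟨hF, hn, hfc, hodd, hNS, hc⟩ := ωC11_cert
  let ω₀ : ΩG (dom (Dl.map (Face.shiftBy (-refShift w)))) (w42.side .W) ((5 : ℤ), (3 : ℤ)) := ⟨.E, colWalk11.mapDomain fun c hc => hB₀ c hc⟩
  have hF' : ω₀.2.firstHitG = 2 := hF
  have hn' : ω₀.2.arcs.length = 16 := hn
  have h₀ : ω₀.IsB2a := by
    refine ΩG.isB2a_of_forall_fc_ne (by rw [hF', hn']; omega) fun j hj1 hj2 => ?_
    rw [hF'] at hj1; rw [hn'] at hj2
    exact hfc j hj2 hj1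
  have hM : ω₀.Mv = 14 := by unfold ΩG.Mv; rw [hF', hn']
  exact ⟨ω₀, h₀, by rw [hM, hF']; exact hodd, by rw [hF']; exact hNS, hc, Or.inl rfl⟩

/-- The reference column witness `(0, 2)` in the back-translated list. [cite: Glazman2015WeightedSAW, Lemma 3.1 (proof, pp. 6–7)] [cite: CourantRobbins1958, Ch. V Appendix §2 (the even–odd rule)] -/
private theorem refWitnessC02 (hB₀ : ∀ c ∈ colBlock42 0 2, c ∈ Dl.map (Face.shiftBy (-refShift w))) :
    ∃ (ω₀ : ΩG (dom (Dl.map (Face.shiftBy (-refShift w)))) (w42.side .W) ((4 : ℤ), (4 : ℤ))) (_ : ω₀.IsB2a),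
      Odd ((Finset.range ω₀.Mv).filter fun j => eastRayB w42 (ω₀.2.nth (ω₀.2.firstHitG + j + 1)) = true).card ∧
      arcKind (ω₀.2.sIn ω₀.2.firstHitG) (ω₀.2.sOut ω₀.2.firstHitG) ≠ .straight ∧ cost (slotOfSide ω₀.1) ω₀.2.mids = 7 ∧ (ω₀.1 = .E ∨ ω₀.1 = .W) := by
  obtain ⟨hF, hn, hfc, hodd, hNS, hc⟩ := ωC02_cert
  let ω₀ : ΩG (dom (Dl.map (Face.shiftBy (-refShift w)))) (w42.side .W) ((4 : ℤ), (4 : ℤ)) := ⟨.E, colWalk02.mapDomain fun c hc => hB₀ c hc⟩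
  have hF' : ω₀.2.firstHitG = 2 := hF
  have hn' : ω₀.2.arcs.length = 16 := hn
  have h₀ : ω₀.IsB2a := by
    refine ΩG.isB2a_of_forall_fc_ne (by rw [hF', hn']; omega) fun j hj1 hj2 => ?_
    rw [hF'] at hj1; rw [hn'] at hj2
    exact hfc j hj2 hj1
  have hM : ω₀.Mv = 14 := by unfold ΩG.Mv; rw [hF', hn']
  exact ⟨ω₀, h₀, by rw [hM, hF']; exact hodd, by rw [hF']; exact hNS, hc, Or.inl rfl⟩

/-- The reference column witness `(1, 2)` in the back-translated list. [cite: Glazman2015WeightedSAW, Lemma 3.1 (proof, pp. 6–7)] [cite: CourantRobbins1958, Ch. V Appendix §2 (the even–odd rule)] -/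
private theorem refWitnessC12 (hB₀ : ∀ c ∈ colBlock42 1 2, c ∈ Dl.map (Face.shiftBy (-refShift w))) :
    ∃ (ω₀ : ΩG (dom (Dl.map (Face.shiftBy (-refShift w)))) (w42.side .W) ((5 : ℤ), (4 : ℤ))) (_ : ω₀.IsB2a),
      Odd ((Finset.range ω₀.Mv).filter fun j => eastRayB w42 (ω₀.2.nth (ω₀.2.firstHitG + j + 1)) = true).card ∧
      arcKind (ω₀.2.sIn ω₀.2.firstHitG) (ω₀.2.sOut ω₀.2.firstHitG) ≠ .straight ∧ cost (slotOfSide ω₀.1) ω₀.2.mids = 7 ∧ (ω₀.1 = .E ∨ ω₀.1 = .W) := by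
  obtain ⟨hF, hn, hfc, hodd, hNS, hc⟩ := ωC12_cert
  let ω₀ : ΩG (dom (Dl.map (Face.shiftBy (-refShift w)))) (w42.side .W) ((5 : ℤ), (4 : ℤ)) := ⟨.E, colWalk12.mapDomain fun c hc => hB₀ c hc⟩
  have hF' : ω₀.2.firstHitG = 3 := hF
  have hn' : ω₀.2.arcs.length = 19 := hn
  have h₀ : ω₀.IsB2a := by
    refine ΩG.isB2a_of_forall_fc_ne (by rw [hF', hn']; omega) fun j hj1 hj2 => ?_
    rw [hF'] at hj1; rw [hn'] at hj2
    exact hfc j hj2 hj1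
  have hM : ω₀.Mv = 16 := by unfold ΩG.Mv; rw [hF', hn']
  exact ⟨ω₀, h₀, by rw [hM, hF']; exact hodd, by rw [hF']; exact hNS, hc, Or.inl rfl⟩

/-- ★★★★ **A WOUND COST-`7` MEMBER WITH A TURNING FIRST ARC AT EVERY RHOMBUS OF THE TWO COLUMNS ABOVE THE ROOT, EVERY POSITION** (`k ≤ 1`, `1 ≤ y ≤ 2`): every face list
containing the block `colBlock w k y` carries a class-`B2a` walk at `(w.1 + k, w.2 + y)` from the root `w.side W` that is WOUND (`A_J ≠ 0`), turns at its first arc in the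
rhombus, has limit cost `7` and a vertical end side. [cite: GlazmanManolescu2019, §4.2 (translation invariance), Lemma 2.1; §1 eq. (1)]
[cite: Glazman2015WeightedSAW, Lemma 3.1 (proof, pp. 6–7)] [cite: CourantRobbins1958, Ch. V Appendix §2 (the even–odd rule)] -/
theorem exists_wound_cost_seven_of_colBlock {k y : ℕ} (hk : k ≤ 1) (hy1 : 1 ≤ y) (hy2 : y ≤ 2) (hB : ∀ c ∈ colBlock w k y, c ∈ Dl)
    (hr : RootedFace (dom Dl) (w.side .W) (w.1 + k, w.2 + y)) :
    ∃ (ω : ΩG (dom Dl) (w.side .W) (w.1 + k, w.2 + y)) (h : ω.IsB2a), ω.AJ hr h (toC (midPt (w.side .W))) ≠ 0 ∧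
      arcKind (ω.2.sIn ω.2.firstHitG) (ω.2.sOut ω.2.firstHitG) ≠ .straight ∧ cost (slotOfSide ω.1) ω.2.mids = 7 ∧ (ω.1 = .E ∨ ω.1 = .W) := by
  have hB₀ := block42_mem_of_block_mem (B := colBlock42 k y) hB
  interval_cases k <;> interval_cases y
  · have hrr : Face.shiftBy (refShift w) (((4 : ℤ), (3 : ℤ)) : Face) = (w.1 + ((0 : ℕ) : ℤ), w.2 + ((1 : ℕ) : ℤ)) := by
      have := shiftBy_refShift_col w 0 1; simpa using this
    obtain ⟨ω₀, h₀, hodd, hNS, hc, hv⟩ := refWitnessC01 hB₀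
    exact ΩG.exists_wound_cost_seven_turn_shift (shiftBy_refShift_root w) hrr hr
      (rootedFace_refShift_back' (shiftBy_refShift_root w) hrr hr) ω₀ h₀ hodd hNS hc hv
  · have hrr : Face.shiftBy (refShift w) (((4 : ℤ), (4 : ℤ)) : Face) = (w.1 + ((0 : ℕ) : ℤ), w.2 + ((2 : ℕ) : ℤ)) := by
      have := shiftBy_refShift_col w 0 2; simpa using this
    obtain ⟨ω₀, h₀, hodd, hNS, hc, hv⟩ := refWitnessC02 hB₀
    exact ΩG.exists_wound_cost_seven_turn_shift (shiftBy_refShift_root w) hrr hr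
      (rootedFace_refShift_back' (shiftBy_refShift_root w) hrr hr) ω₀ h₀ hodd hNS hc hv
  · have hrr : Face.shiftBy (refShift w) (((5 : ℤ), (3 : ℤ)) : Face) = (w.1 + ((1 : ℕ) : ℤ), w.2 + ((1 : ℕ) : ℤ)) := by
      have := shiftBy_refShift_col w 1 1; simpa using this
    obtain ⟨ω₀, h₀, hodd, hNS, hc, hv⟩ := refWitnessC11 hB₀
    exact ΩG.exists_wound_cost_seven_turn_shift (shiftBy_refShift_root w) hrr hr
      (rootedFace_refShift_back' (shiftBy_refShift_root w) hrr hr) ω₀ h₀ hodd hNS hc hv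
  · have hrr : Face.shiftBy (refShift w) (((5 : ℤ), (4 : ℤ)) : Face) = (w.1 + ((1 : ℕ) : ℤ), w.2 + ((2 : ℕ) : ℤ)) := by
      have := shiftBy_refShift_col w 1 2; simpa using this
    obtain ⟨ω₀, h₀, hodd, hNS, hc, hv⟩ := refWitnessC12 hB₀
    exact ΩG.exists_wound_cost_seven_turn_shift (shiftBy_refShift_root w) hrr hr
      (rootedFace_refShift_back' (shiftBy_refShift_root w) hrr hr) ω₀ h₀ hodd hNS hc hv

/-- ★★★★ **THE HYPOTHESIS `hex` OF THE COLUMN LAW, DISCHARGED** (`k ≤ 1`, `1 ≤ y ≤ 2`): a wound class-`B2a` walk at `(w.1 + k, w.2 + y)` with a turning first arc whose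
three-arc extension has limit cost `5`. [cite: GlazmanManolescu2019, Lemma 2.1 (proof: the groups of three walks); §1 eq. (1); §4.2]
[cite: Glazman2015WeightedSAW, Lemma 3.1 (proof, pp. 6–7)] [cite: CourantRobbins1958, Ch. V Appendix §2 (the even–odd rule)] -/
theorem exists_wound_ext₃_cost_five_of_colBlock {k y : ℕ} (hk : k ≤ 1) (hy1 : 1 ≤ y) (hy2 : y ≤ 2) (hB : ∀ c ∈ colBlock w k y, c ∈ Dl)
    (hr : RootedFace (dom Dl) (w.side .W) (w.1 + k, w.2 + y)) :
    ∃ (ω : ΩG (dom Dl) (w.side .W) (w.1 + k, w.2 + y)) (h : ω.IsB2a), ω.AJ hr h (toC (midPt (w.side .W))) ≠ 0 ∧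
      arcKind (ω.2.sIn ω.2.firstHitG) (ω.2.sOut ω.2.firstHitG) ≠ .straight ∧ cost (slotOfSide (ω.ext₃ hr).1) (ω.ext₃ hr).2.mids = 5 := by
  obtain ⟨ω, h, hA, hNS, hc, hv⟩ := exists_wound_cost_seven_of_colBlock hk hy1 hy2 hB hr
  exact ⟨ω, h, hA, hNS, (ΩG.cost_ext₃_eq_five_iff hr h hNS).2 (Or.inr ⟨hc, hv⟩)⟩

/-- ★★★★★ **THE COLUMN LAW ABOVE THE ROOT ROW, CLOSED FORM.** For every finite face list `Dl` missing the hole `(w.1 − 1, w.2)` and containing the block `colBlock w k y`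
(`k ≤ 1`, `1 ≤ y ≤ 2`), the printed Yang–Baxter vertex functional at the root `w.side W` and the rhombus `(w.1 + k, w.2 + y)` above the root row has finitely many zeros
in `(0, π)`, at most `4·maxExp − 4`. [cite: GlazmanManolescu2019, Lemma 2.1 and eq. (1); Remark 2.2; §4.2] [cite: Glazman2015WeightedSAW, Lemma 3.1 (proof, pp. 6–7)] -/
theorem vertexFunctional_printed_zero_set_finite_of_colBlock {k y : ℕ} (hk : k ≤ 1) (hy1 : 1 ≤ y) (hy2 : y ≤ 2) (hh : holeFaceW w ∉ dom Dl)
    (hB : ∀ c ∈ colBlock w k y, c ∈ Dl) (hr : RootedFace (dom Dl) (w.side .W) (w.1 + k, w.2 + y)) :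
    {θ ∈ Set.Ioo 0 π | vertexFunctional (printedWeights θ) tFiveEighths (ybCoeff θ) Dl (w.side .W) (w.1 + k, w.2 + y) = 0}.Finite ∧
      {θ ∈ Set.Ioo 0 π | vertexFunctional (printedWeights θ) tFiveEighths (ybCoeff θ) Dl (w.side .W) (w.1 + k, w.2 + y) = 0}.ncard ≤
        4 * maxExp Dl (w.side .W) (w.1 + k, w.2 + y) + 1 - 5 :=
  vertexFunctional_printed_zero_set_finite_above Dl hh hr (by simp only; omega) (by simp only; omega)
    (exists_wound_ext₃_cost_five_of_colBlock hk hy1 hy2 hB hr)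

/-- ★★★★★ **NOT IDENTICALLY ZERO ABOVE THE ROOT ROW, CLOSED FORM**: under the same hypotheses some `θ ∈ (0, π)` has `VF_D(w.side W, (w.1 + k, w.2 + y); θ) ≠ 0`.
[cite: GlazmanManolescu2019, Lemma 2.1 and eq. (1); Remark 2.2; §4.2] [cite: Glazman2015WeightedSAW, Lemma 3.1 (proof, pp. 6–7)] -/
theorem vertexFunctional_printed_exists_ne_zero_of_colBlock {k y : ℕ} (hk : k ≤ 1) (hy1 : 1 ≤ y) (hy2 : y ≤ 2) (hh : holeFaceW w ∉ dom Dl)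
    (hB : ∀ c ∈ colBlock w k y, c ∈ Dl) (hr : RootedFace (dom Dl) (w.side .W) (w.1 + k, w.2 + y)) :
    ∃ θ ∈ Set.Ioo 0 π, vertexFunctional (printedWeights θ) tFiveEighths (ybCoeff θ) Dl (w.side .W) (w.1 + k, w.2 + y) ≠ 0 :=
  vertexFunctional_printed_exists_ne_zero_above Dl hh hr (by simp only; omega) (by simp only; omega)
    (exists_wound_ext₃_cost_five_of_colBlock hk hy1 hy2 hB hr)

end Translate

end Literature.Barriers.CriticalPhenomena.PlaquetteWalk
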